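import Summits.BirchSwinnertonDyer.BirchSwinnertonDyer.Theorems.PrintCFramBottomClassIndexLawFiveLeBorelRequestsCebotarev
import HarnessLib

/-!
# Route `PrintCFram`, crux C2 `BottomClassIndexLawFiveLe` (stmt-BirchSwinnertonDyer-20372), line
# `eisenstein-resource-bdp-line`, stub `stub_kolyvaginUpper_borelCM_pairSum_offKrizLi`:
# **SHAPE (B3) ON `H¹(K, W[p^M])` — `x ↦ 0` JOINTLY WITH A DECORRELATED `η`-CLASS AND A `(−η)`-CLASS**
# (cell `bsd-print-cfram`, seat `bsd-line-cfram-p1-w2` g7; helper `--supports` 20372; 0 facts, 0 defs, 0 sorry)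

HONEST FRAMING. Nothing about BSD is proved here, and nothing of the stub itself. The abstract Borel descent
(`…BorelDescentClaimB`, `claimB_core`) asks Čebotarev for ONE joint request (`hceb3`): a Kolyvagin prime at
which `x_λ = 0`, an `η`-class `s` top-independent of `x` has a prescribed order `≤ ord`, and a `(−η)`-class `w`
has a prescribed order `≤ p^{⌊e_w/2⌋}`. This file proves it on `H¹(K, W[p^M])`:

* **`exists_kolyvaginPrime_gt_pow_requests_triple`** — FILE 7′ (`…_requests_of_cmRamified`) on the family
  `![x, s, w]` with `hind` discharged by `hind_of_hind_on_classes` (`…BorelTopLayerHind`): the class of `w`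
  (sign `−η`) contains neither `x` nor `s`, so its relations are `b·T_w = 0` (`p ∣ b` from a non-zero top); a
  class of sign `η` excludes `w`, so its relations are `a·T_x + b·T_s = 0`, settled by the HYPOTHESIS that the
  tops of `x` and `s` are independent — the output of the split (B4) (`…BorelTopSplit.exists_sub_zsmul_top_indep`,
  applied to `s − k·x`).

So all four Čebotarev-side displayed hypotheses (B1)–(B4) of the abstract Borel descent are theorems on
`H¹(K, W[p^M])` for the CM class (modulo `chebotarev_artinRep` and the dictionary `A ℓ` = `torsionLocalKer`,
`Kol` = the printed conditions, `dp` = exact depth); what remains of `HypothesesM`'s data at the Borel prime is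
exactly the classical debt (Kolyvagin's classes `c(n)`, Prop. 4.4, Lemma 5.3 at the additive prime). THEOREMS
ONLY; no definition, no named fact introduced, no `sorry`. BSD is not proved by any of this; no summit statement is
proved by this seat. Reference: [McCallumLMS1991] §3 Cor. 3.2.
-/

set_option autoImplicit false
-- `…BirchSwinnertonDyer.BirchSwinnertonDyer.Theorems…` is the problem's mandated namespace (D-0017).
set_option linter.dupNamespace false

noncomputable section

open scoped Classical

namespace Summit.BirchSwinnertonDyer.BirchSwinnertonDyer.Theorems.PrintCFram.BorelKolyvaginPairing

open WeierstrassCurve NumberField IsDedekindDomain Field Literature.NumberTheory.EllipticCurves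
  Literature.NumberTheory.GaloisRepresentations Literature.NumberTheory.EllipticCurves.Rank1Residual
  Summit.BirchSwinnertonDyer.BirchSwinnertonDyer.Theorems.PrintCFram.BorelHomothety

variable (W : WeierstrassCurve ℚ) [W.IsElliptic] (p : ℕ) [hp : Fact p.Prime]
variable {K : Type} [Field K] [NumberField K]

/-- **Shape (B3) on `H¹(K, W[p^M])`.** `W` CM, `5 ≤ p` CM-ramified, `𝓞_𝔭`-structure `(s₀, μ, m)`; `K` imaginary
quadratic with `−p` a non-square, complex conjugation `c` lifted along `c₀`, line sign `η`; `M ≥ 1`. Let `x`, `s`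
be `c_*`-eigenclasses of sign `η` and `w` one of sign `−η`, with values killed by `μ^{e_x}`, `μ^{e_s}`, `μ^{e_w}`,
`w` with a non-zero top, and suppose the tops of `x` and `s` are INDEPENDENT
(`a T_x + b T_s = 0 ⟹ p ∣ a ∧ p ∣ b`). Then for requests `2N_s ≤ e_s + 1`, `2N_w ≤ e_w`, above every `b` there is
a Kolyvagin prime `ℓ` of level `p^M` with **`x_λ = 0`, `ord s_λ = p^{N_s}`, `ord w_λ = p^{N_w}`** (kernel form).
This is the displayed hypothesis `hceb3` of `…BorelDescentClaimB`. [cite: McCallumLMS1991, §3 Cor. 3.2] -/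
theorem exists_kolyvaginPrime_gt_pow_requests_triple
    (hC : Literature.NumberTheory.Automorphic.chebotarev_artinRep) {N : ℕ} [NeZero N]
    (hCM : W.HasCM) (h5 : 5 ≤ p) (hram : CMRamified W p)
    {s₀ : AlgebraicClosure ℚ} {μ : AddMonoid.End W.geomPoints} {m : ℤ}
    (hs : s₀ ^ 2 = ((-(p : ℤ) : ℤ) : AlgebraicClosure ℚ)) (hm : m.natAbs = p)
    (hμμ : ∀ P, μ (μ P) = m • P)
    (hcomm : ∀ g : absoluteGaloisGroup ℚ, g • s₀ = s₀ → ∀ P, μ (g • P) = g • μ P)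
    (hanti : ∀ g : absoluteGaloisGroup ℚ, g • s₀ = -s₀ → ∀ P, μ (g • P) = -(g • μ P))
    (hK : IsImaginaryQuadratic K) (hKp : ∀ y : K, y ^ 2 ≠ -(p : K)) {M : ℕ} (hM : 1 ≤ M)
    {c : K ≃ₐ[ℚ] K} {c₀ : absoluteGaloisGroup ℚ} (hc₀ : IsComplexConjugation (Rat.castHom ℝ) c₀)
    (ht : IsLiftOfAut c (absGaloisTransport (K := ℚ) (L := K) c₀).toRingEquiv)
    {η : ℤ} (hηs : η = 1 ∨ η = -1) (hη : ∀ P : W.geomPoints, μ P = 0 → c₀ • P = η • P)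
    {x s w : galH1Torsion (W.baseChange K) ((p ^ M : ℕ) : ℤ)}
    (hx : conjAct W c ((p ^ M : ℕ) : ℤ) x = η • x) (hsg : conjAct W c ((p ^ M : ℕ) : ℤ) s = η • s)
    (hw : conjAct W c ((p ^ M : ℕ) : ℤ) w = (-η) • w)
    {ex es ew : ℕ}
    (hxe : ∀ ρ ∈ torsionFixing (W.baseChange K) ((p ^ M : ℕ) : ℤ),
      (μ ^ ex) ((RatClosure.torsionEquiv (K := K) W ((p ^ M : ℕ) : ℤ)).symm
        (h1Eval (W.baseChange K) ((p ^ M : ℕ) : ℤ) x ρ) : W.geomPoints) = 0)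
    (hse : ∀ ρ ∈ torsionFixing (W.baseChange K) ((p ^ M : ℕ) : ℤ),
      (μ ^ es) ((RatClosure.torsionEquiv (K := K) W ((p ^ M : ℕ) : ℤ)).symm
        (h1Eval (W.baseChange K) ((p ^ M : ℕ) : ℤ) s ρ) : W.geomPoints) = 0)
    (hwe : ∀ ρ ∈ torsionFixing (W.baseChange K) ((p ^ M : ℕ) : ℤ),
      (μ ^ ew) ((RatClosure.torsionEquiv (K := K) W ((p ^ M : ℕ) : ℤ)).symm
        (h1Eval (W.baseChange K) ((p ^ M : ℕ) : ℤ) w ρ) : W.geomPoints) = 0)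
    (hwtop : ∃ ρ ∈ torsionFixing (W.baseChange K) ((p ^ M : ℕ) : ℤ),
      (μ ^ (ew - 1)) ((RatClosure.torsionEquiv (K := K) W ((p ^ M : ℕ) : ℤ)).symm
        (h1Eval (W.baseChange K) ((p ^ M : ℕ) : ℤ) w ρ) : W.geomPoints) ≠ 0)
    (hxs : ∀ a b : ℤ, (∀ ρ ∈ torsionFixing (W.baseChange K) ((p ^ M : ℕ) : ℤ),
      a • (μ ^ (ex - 1)) ((RatClosure.torsionEquiv (K := K) W ((p ^ M : ℕ) : ℤ)).symm
        (h1Eval (W.baseChange K) ((p ^ M : ℕ) : ℤ) x ρ) : W.geomPoints) +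
      b • (μ ^ (es - 1)) ((RatClosure.torsionEquiv (K := K) W ((p ^ M : ℕ) : ℤ)).symm
        (h1Eval (W.baseChange K) ((p ^ M : ℕ) : ℤ) s ρ) : W.geomPoints) = 0) →
      (p : ℤ) ∣ a ∧ (p : ℤ) ∣ b)
    {Ns Nw : ℕ} (hNs : 2 * Ns ≤ es + 1) (hNw : 2 * Nw ≤ ew) (b : ℕ) :
    ∃ ℓ : ℕ, b < ℓ ∧ ℓ.Prime ∧ ¬ ℓ ∣ N ∧ ¬ ((ℓ : ℤ) ∣ NumberField.discr K) ∧ ℓ ≠ p ∧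
      (Ideal.span {(ℓ : 𝓞 K)}).IsPrime ∧ FrobEqFrobInfty W K (p ^ M) ℓ ∧
      ∀ v : HeightOneSpectrum (𝓞 K), (ℓ : 𝓞 K) ∈ v.asIdeal →
        x ∈ (W.baseChange K).torsionLocalKer (v.adicCompletion K) ((p ^ M : ℕ) : ℤ) ∧
        (((p : ℤ) ^ Ns) • s ∈ (W.baseChange K).torsionLocalKer (v.adicCompletion K) ((p ^ M : ℕ) : ℤ) ∧
          (Ns ≠ 0 → ((p : ℤ) ^ (Ns - 1)) • s ∉
            (W.baseChange K).torsionLocalKer (v.adicCompletion K) ((p ^ M : ℕ) : ℤ))) ∧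
        (((p : ℤ) ^ Nw) • w ∈ (W.baseChange K).torsionLocalKer (v.adicCompletion K) ((p ^ M : ℕ) : ℤ) ∧
          (Nw ≠ 0 → ((p : ℤ) ^ (Nw - 1)) • w ∉
            (W.baseChange K).torsionLocalKer (v.adicCompletion K) ((p ^ M : ℕ) : ℤ))) := by
  have hp2 : p ≠ 2 := by have := hp.out.two_le; omega
  have hηne : -η ≠ η := by rcases hηs with rfl | rfl <;> decide
  -- the family `![x, s, w]`
  have hν : ∀ i : Fin 3, (![η, η, -η] : Fin 3 → ℤ) i = 1 ∨ (![η, η, -η] : Fin 3 → ℤ) i = -1 := fun i ↦ by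
    fin_cases i
    · exact hηs
    · exact hηs
    · rcases hηs with h | h <;> simp [h]
  have hxs3 : ∀ i : Fin 3, conjAct W c ((p ^ M : ℕ) : ℤ) (![x, s, w] i) =
      (![η, η, -η] : Fin 3 → ℤ) i • ![x, s, w] i := fun i ↦ by
    fin_cases i
    · exact hx
    · exact hsg
    · exact hw
  have he3 : ∀ i : Fin 3, ∀ ρ ∈ torsionFixing (W.baseChange K) ((p ^ M : ℕ) : ℤ),
      (μ ^ (![ex, es, ew] : Fin 3 → ℕ) i) ((RatClosure.torsionEquiv (K := K) W ((p ^ M : ℕ) : ℤ)).symm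
        (h1Eval (W.baseChange K) ((p ^ M : ℕ) : ℤ) (![x, s, w] i) ρ) : W.geomPoints) = 0 := fun i ↦ by
    fin_cases i
    · exact hxe
    · exact hse
    · exact hwe
  -- `hind` from `hind` on the (parity, sign) classes
  have hind : ∀ a : Fin 3 → ℤ,
      (∀ ρ ∈ torsionFixing (W.baseChange K) ((p ^ M : ℕ) : ℤ),
        ∑ i, a i • (μ ^ ((![ex, es, ew] : Fin 3 → ℕ) i - 1))
          ((RatClosure.torsionEquiv (K := K) W ((p ^ M : ℕ) : ℤ)).symm
            (h1Eval (W.baseChange K) ((p ^ M : ℕ) : ℤ) (![x, s, w] i) ρ) : W.geomPoints) = 0) →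
        ∀ i, 0 < (![ex, es, ew] : Fin 3 → ℕ) i → (p : ℤ) ∣ a i := by
    refine hind_of_hind_on_classes W p hs hm hμμ hanti hp2 hKp hc₀ ht hηs hη ((p ^ M : ℕ) : ℤ) ![x, s, w] hν
      hxs3 ![ex, es, ew] he3 ?_
    intro α β hα hβ bv hsupp hrel i _
    -- the relation, written out on the three members
    have hrel3 : ∀ ρ ∈ torsionFixing (W.baseChange K) ((p ^ M : ℕ) : ℤ),
        bv 0 • (μ ^ (ex - 1)) ((RatClosure.torsionEquiv (K := K) W ((p ^ M : ℕ) : ℤ)).symm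
          (h1Eval (W.baseChange K) ((p ^ M : ℕ) : ℤ) x ρ) : W.geomPoints) +
        bv 1 • (μ ^ (es - 1)) ((RatClosure.torsionEquiv (K := K) W ((p ^ M : ℕ) : ℤ)).symm
          (h1Eval (W.baseChange K) ((p ^ M : ℕ) : ℤ) s ρ) : W.geomPoints) +
        bv 2 • (μ ^ (ew - 1)) ((RatClosure.torsionEquiv (K := K) W ((p ^ M : ℕ) : ℤ)).symm
          (h1Eval (W.baseChange K) ((p ^ M : ℕ) : ℤ) w ρ) : W.geomPoints) = 0 := fun ρ hρ ↦ by
      have h := hrel ρ hρ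
      rw [Fin.sum_univ_three] at h
      simpa using h
    by_cases hβ' : β = η
    · -- a class of sign `η`: `w` is outside, so `b_w = 0` and the relation is `b_x T_x + b_s T_s = 0`
      have hb2 : bv 2 = 0 := hsupp 2 (by
        rintro ⟨-, h2⟩
        exact hηne (by simpa using h2.trans hβ'))
      have hb01 := hxs (bv 0) (bv 1) (fun ρ hρ ↦ by
        have h := hrel3 ρ hρ
        rwa [hb2, zero_smul, add_zero] at h)
      fin_cases i
      · exact hb01.1
      · exact hb01.2
      · change (p : ℤ) ∣ bv 2
        rw [hb2]; exact dvd_zero _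
    · -- a class of sign `−η` (or an empty one): `x`, `s` are outside
      have hb0 : bv 0 = 0 := hsupp 0 (by rintro ⟨-, h0⟩; exact hβ' (by simpa using h0.symm))
      have hb1 : bv 1 = 0 := hsupp 1 (by rintro ⟨-, h1⟩; exact hβ' (by simpa using h1.symm))
      fin_cases i
      · change (p : ℤ) ∣ bv 0
        rw [hb0]; exact dvd_zero _
      · change (p : ℤ) ∣ bv 1
        rw [hb1]; exact dvd_zero _
      · change (p : ℤ) ∣ bv 2
        obtain ⟨ρ₀, hρ₀, hρ₀top⟩ := hwtop
        have h := hrel3 ρ₀ hρ₀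
        rw [hb0, hb1, zero_smul, zero_smul, zero_add, zero_add] at h
        exact prime_dvd_of_zsmul_eq_zero p hp.out hρ₀top
          (prime_zsmul_eq_zero_of_apply_eq_zero W p hm hμμ (apply_top_eq_zero W (hwe ρ₀ hρ₀))) h
  obtain ⟨ℓ, hbℓ, hℓ, hℓN, hℓD, hℓp, hprime, hfrob, hloc⟩ :=
    exists_kolyvaginPrime_gt_pow_requests_of_cmRamified W p hC (N := N) hCM h5 hram hs hm hμμ hcomm hanti
      hK hM hc₀ ht hηs hη ![x, s, w] hxs3 ![ex, es, ew] he3 hind ![0, Ns, Nw]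
      (fun i ↦ by
        fin_cases i
        · exact Or.inl rfl
        · exact Or.inr (Or.inl ⟨rfl, hNs⟩)
        · exact Or.inr (Or.inr ⟨rfl, hNw⟩)) b
  refine ⟨ℓ, hbℓ, hℓ, hℓN, hℓD, hℓp, hprime, hfrob, fun v hv ↦ ⟨?_, hloc 1 v hv, hloc 2 v hv⟩⟩
  have h0 := (hloc 0 v hv).1
  simp only [Matrix.cons_val_zero, pow_zero, one_smul] at h0
  exact h0

end Summit.BirchSwinnertonDyer.BirchSwinnertonDyer.Theorems.PrintCFram.BorelKolyvaginPairing

end
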